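import Mathlib
import HarnessLib
import Summits.NavierStokesRegularity.NavierStokesRegularity.Theorems.PoloidalWindowDoorLrcModEntireSheetFlattenTools

/-!
# Route `PoloidalWindowDoor`, item `LrcModEntire` (stmt-NavierStokesRegularity-20428), cell (Q4) of the (TH) column —
# FLATTENING THE WEB SHEET: from the slice law of the signed vertical velocity and a family of parallel web LINES to the
# vanishing of its derivative along the lines (brick W0 of LEAD memo T2B-g16 §3/§6(iii))

Cell ns-regularity-ideate, LEAD-lineage seat ns-poloidal-K2-p3 g16 (`--supports stmt-NavierStokesRegularity-20428`).

Let `θ : ℝ³ → ℝ` be real-analytic, let `e` be a horizontal unit vector with `ν = Je = (−e₁, e₀, 0)`, and suppose that on the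
slab `{x₂ ∈ I}` (`I` open) the SLICE LAW `∂₂²θ = −μ(x₂)(∂₀²θ + ∂₁²θ)` holds (tree `…TimeHeightShearLinearSlice.plane_wave_identity`
on proportional-shear planes) and that along the LINES `ℓ_z = {s·e + d(z)·ν + z·e₂ : s ∈ ℝ}` (`z ∈ I`, `d` smooth) the horizontal
gradient of `θ` vanishes: `∂_eθ = ∂_νθ = 0` on `ℓ_z` (the parallel web of a straight hot branch, memo §2).  If the sheet
`⋃_z ℓ_z` is NON-CHARACTERISTIC, `d′(z)² + μ(z) ≠ 0` on `I`, then `∂_eθ ≡ 0` on the slab (`fderiv_apply_eq_zero_on_slab`).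

Proof: flatten by the isometry `L(s,n,z) = s·e + n·ν + z·e₂` (`Θ = θ ∘ L` solves `∂_z∂_zΘ + μ(∂_s∂_sΘ + ∂_n∂_nΘ) = 0`, the
horizontal Laplacian being rotation invariant), pass to `η̃ = ∂_sΘ` (the operator commutes with `∂_s`), shear by the web
(`H(s,n,z) = η̃(s, n + d(z), z)` solves the sheared equation with `A = −2d′`, `B = −d″`, `Q = d′² + μ` and carries zero Cauchy
data on `{n = 0}`), and apply the landed Cauchy–Kovalevskaya uniqueness `…SheetCauchyUniqueness.eq_zero_on_slab`.

WHAT THIS IS NOT: not a claim about Navier–Stokes regularity; a calculus brick (bears_on LADDER-NS N0 via item 20428).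
-/

noncomputable section

set_option linter.dupNamespace false
set_option linter.unusedVariables false

namespace Summit.NavierStokesRegularity.NavierStokesRegularity.Theorems.PoloidalWindowDoorLrcModEntireSheetFlatten

open Set Function Filter Topology
open scoped ContDiff
open Summit.NavierStokesRegularity.NavierStokesRegularity.Theorems.PoloidalWindowDoorLrcModEntireSheetCauchyUniqueness
open Summit.NavierStokesRegularity.NavierStokesRegularity.Theorems.PoloidalWindowDoorLrcModEntireSheetFlattenTools

/-! ### The theorem -/

/-- **FLATTENING THE WEB SHEET.**  Let `θ : ℝ³ → ℝ` be real-analytic, `e` a horizontal unit vector, `I` an open set of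
heights, `μ` differentiable and `d` smooth on `I`.  Suppose the slice law `∂₂²θ = −μ(x₂)(∂₀²θ + ∂₁²θ)` holds on the slab
`{x₂ ∈ I}`, the horizontal gradient of `θ` vanishes along the lines `{s·e + d(z)·Je + z·e₂}` (`z ∈ I`), and the sheet of
these lines is non-characteristic: `d′(z)² + μ(z) ≠ 0` on `I`.  Then `∂_eθ = 0` on the whole slab. -/
theorem fderiv_apply_eq_zero_on_slab {θ : EuclideanSpace ℝ (Fin 3) → ℝ} (hθ : AnalyticOnNhd ℝ θ univ)
    {I : Set ℝ} (hI : IsOpen I) {μ d : ℝ → ℝ} (hμ : ∀ z ∈ I, DifferentiableAt ℝ μ z) (hd : ContDiffOn ℝ ∞ d I)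
    {e : EuclideanSpace ℝ (Fin 3)} (he2 : e 2 = 0) (hunit : e 0 ^ 2 + e 1 ^ 2 = 1)
    (hlaw : ∀ x : EuclideanSpace ℝ (Fin 3), x 2 ∈ I →
      fderiv ℝ (fun y => fderiv ℝ θ y (EuclideanSpace.single 2 (1 : ℝ))) x (EuclideanSpace.single 2 (1 : ℝ)) =
        -μ (x 2) * (fderiv ℝ (fun y => fderiv ℝ θ y (EuclideanSpace.single 0 (1 : ℝ))) x (EuclideanSpace.single 0 (1 : ℝ)) +
          fderiv ℝ (fun y => fderiv ℝ θ y (EuclideanSpace.single 1 (1 : ℝ))) x (EuclideanSpace.single 1 (1 : ℝ))))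
    (hweb : ∀ s : ℝ, ∀ z ∈ I, fderiv ℝ θ (s • e + d z • Jvec e + z • e2) e = 0 ∧
      fderiv ℝ θ (s • e + d z • Jvec e + z • e2) (Jvec e) = 0)
    (hQ : ∀ z ∈ I, deriv d z ^ 2 + μ z ≠ 0) :
    ∀ x : EuclideanSpace ℝ (Fin 3), x 2 ∈ I → fderiv ℝ θ x e = 0 := by
  -- smoothness
  have hθω : ContDiff ℝ ∞ θ := (contDiffOn_univ.1 (hθ.contDiffOn uniqueDiffOn_univ)).of_le le_top
  have hθ2 : ContDiff ℝ 2 θ := hθω.of_le (by norm_cast)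
  have hθd : Differentiable ℝ θ := hθω.differentiable (by simp)
  set Θ : ℝ × ℝ × ℝ → ℝ := fun q => θ (frameCLM e q) with hΘ
  have hΘs : ContDiff ℝ ∞ Θ := hθω.comp (frameCLM e).contDiff
  have hΘon : ContDiffOn ℝ ∞ Θ (slab I) := hΘs.contDiffOn
  set K : ℝ × ℝ × ℝ → ℝ := pd eS Θ with hK
  have hKf : K = fun q => fderiv ℝ θ (frameCLM e q) e := by
    rw [hK, hΘ, pd_comp_frame_fun hθd e eS]
    simp only [frameCLM_eS]
  have hηs : ContDiff ℝ ∞ (fun x => fderiv ℝ θ x e) :=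
    (hθω.fderiv_right (m := ∞) (by norm_cast)).clm_apply contDiff_const
  have hKs : ContDiff ℝ ∞ K := by rw [hKf]; exact hηs.comp (frameCLM e).contDiff
  -- the equations
  have hΘpde : ∀ p ∈ slab I, sheetOp (fun _ => 0) (fun _ => 0) μ μ Θ p = 0 :=
    sheetOp_frame_eq_zero hθ2 hlaw he2 hunit
  have hc0 : ∀ z ∈ I, DifferentiableAt ℝ (fun _ : ℝ => (0 : ℝ)) z := fun z _ => differentiableAt_const _
  have hKpde : ∀ p ∈ slab I, sheetOp (fun _ => 0) (fun _ => 0) μ μ K p = 0 :=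
    sheetOp_pdS_eq_zero hI hc0 hc0 hμ hμ hΘon hΘpde
  set H : ℝ × ℝ × ℝ → ℝ := fun q => K (shear d q) with hH
  have hHpde := sheetOp_shear_eq_zero hI hKs hKpde hd
  have hHs : ContDiffOn ℝ ∞ H (slab I) := contDiffOn_shear hI hKs hd
  -- derivatives of `d`
  have hdd : ∀ z ∈ I, DifferentiableAt ℝ d z := fun z hz =>
    (hd.contDiffAt (hI.mem_nhds hz)).differentiableAt (by simp)
  have hd1 : ContDiffOn ℝ ∞ (deriv d) I := hd.deriv_of_isOpen hI (m := ∞) (by simp)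
  have hdd1 : ∀ z ∈ I, DifferentiableAt ℝ (deriv d) z := fun z hz =>
    (hd1.contDiffAt (hI.mem_nhds hz)).differentiableAt (by simp)
  have hd2 : ContDiffOn ℝ ∞ (deriv (deriv d)) I := hd1.deriv_of_isOpen hI (m := ∞) (by simp)
  have hdd2 : ∀ z ∈ I, DifferentiableAt ℝ (deriv (deriv d)) z := fun z hz =>
    (hd2.contDiffAt (hI.mem_nhds hz)).differentiableAt (by simp)
  have hA : ∀ z ∈ I, DifferentiableAt ℝ (fun z => -2 * deriv d z) z := fun z hz => (hdd1 z hz).const_mul _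
  have hB : ∀ z ∈ I, DifferentiableAt ℝ (fun z => -(deriv (deriv d) z)) z := fun z hz => (hdd2 z hz).neg
  have hQd : ∀ z ∈ I, DifferentiableAt ℝ (fun z => deriv d z ^ 2 + μ z) z := fun z hz =>
    ((hdd1 z hz).pow 2).add (hμ z hz)
  -- the Cauchy data
  have hshear0 : ∀ s z : ℝ, shear d (s, 0, z) = (s, d z, z) := fun s z => by simp [shear]
  have hframe : ∀ s m z : ℝ, frameCLM e (s, m, z) = s • e + m • Jvec e + z • e2 := fun s m z => by
    rw [frameCLM_apply]
  have h0 : ∀ s : ℝ, ∀ z ∈ I, H (s, 0, z) = 0 := by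
    intro s z hz
    simp only [hH, hshear0, hKf, hframe]
    exact (hweb s z hz).1
  have hNΘ : ∀ s : ℝ, ∀ z ∈ I, pd eN Θ (s, d z, z) = 0 := by
    intro s z hz
    rw [hΘ, pd_comp_frame hθd e eN, frameCLM_eN, hframe]
    exact (hweb s z hz).2
  have h1 : ∀ s : ℝ, ∀ z ∈ I, pd eN H (s, 0, z) = 0 := by
    intro s z hz
    have hp : ((s, 0, z) : ℝ × ℝ × ℝ) ∈ slab I := hz
    rw [hH, pd_shear_eN hI hKs.contDiffOn hp (hdd z hz), hshear0, hK]
    have hq : ((s, d z, z) : ℝ × ℝ × ℝ) ∈ slab I := hz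
    rw [pd_comm hI hΘon eN eS hq]
    have hNs : ContDiffOn ℝ ∞ (pd eN Θ) (slab I) := contDiffOn_pd hI hΘon eN
    exact pdS_eq_zero_of_vanish_on_line (fun s' => hNΘ s' z hz) (differentiableAt_of_slab hI hNs hq)
  -- analyticity along `n`-lines
  have hηan : AnalyticOnNhd ℝ (fun x => fderiv ℝ θ x e) univ :=
    (ContinuousLinearMap.apply ℝ ℝ e).comp_analyticOnNhd hθ.fderiv
  have han : ∀ s : ℝ, ∀ z ∈ I, AnalyticOnNhd ℝ (fun n : ℝ => H (s, n, z)) univ := by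
    intro s z hz n _
    have e1 : (fun n : ℝ => H (s, n, z)) = fun n => fderiv ℝ θ (frameCLM e (s, n + d z, z)) e := by
      funext n; simp [hH, hKf, shear]
    rw [e1]
    have haff : AnalyticAt ℝ (fun n : ℝ => frameCLM e (s, n + d z, z)) n := by
      have h1 : AnalyticAt ℝ (fun n : ℝ => ((s, n + d z, z) : ℝ × ℝ × ℝ)) n :=
        analyticAt_const.prod ((analyticAt_id.add analyticAt_const).prod analyticAt_const)
      exact (frameCLM e).analyticAt _ |>.comp h1
    exact (hηan _ (mem_univ _)).comp haff
  -- Cauchy–Kovalevskaya uniqueness across the sheet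
  have hzero := eq_zero_on_slab hI hA hB hQd hμ hQ hHs han hHpde h0 h1
  -- back to `θ`
  intro x hx
  set z := x 2 with hz
  set s₀ : ℝ := x 0 * e 0 + x 1 * e 1 with hs₀
  set m : ℝ := -(x 0) * e 1 + x 1 * e 0 with hm
  have hxe : frameCLM e (s₀, m, z) = x := by
    rw [frameCLM_apply]
    ext i
    fin_cases i
    · simp [Jvec, e2, hs₀, hm]
      linear_combination x 0 * hunit
    · simp [Jvec, e2, hs₀, hm]
      linear_combination x 1 * hunit
    · simp [Jvec, e2, he2, hz]
  have h := hzero s₀ (m - d z) z hx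
  have hsh : shear d (s₀, m - d z, z) = (s₀, m, z) := by simp [shear]
  rw [hH] at h
  simp only [hsh] at h
  rw [hKf] at h
  simp only [hxe] at h
  exact h

end Summit.NavierStokesRegularity.NavierStokesRegularity.Theorems.PoloidalWindowDoorLrcModEntireSheetFlatten
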